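import Literature.Computability.MetaComplexity.KrajicekRamseyReduction
import HarnessLib

/-!
# Bounded-depth Frege: truth-table derivations and the transfer of a refutation along a substitution

Support file for the (conditional) discharge of
`Literature.Computability.MetaComplexity.galesiEtAl_tseitin_treewidth_depthFrege_lowerBound`
(Galesi–Itsykson–Riazanov–Sofronova, APAL 2023, Thm. 18; `TseitinDepthFrege.lean`). The printed
proof (§3.1) moves a bounded-depth Frege proof of `¬T(G, f)` to a proof of `¬T(H, f')` for a
topological minor `H` of `G` by (a) applying a substitution to the whole proof and (b) deriving the
new Tseitin formula from the substituted one block by block, each block depending on `O(1)`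
variables, by brute force over the assignments of those variables:

* GIRS Lemma 4: "Let `ψ₁` and `ψ₂` be two formulas of depth at most `d` such that
  `|vars(ψ₁) ∪ vars(ψ₂)| = k` and `ψ₁` semantically implies `ψ₂`. Then there exists a derivation
  `ψ₁ ⊢_d ψ₂` of size at most `2^k (|ψ₁|² + |ψ₂|²)`" (Pavel first asks the `k` variables, then all
  subformulas bottom-up);
* GIRS Lemma 10: from `¬ ⋀_a Φ'_a` derive `¬ ⋀_{a ∈ A'} Φ_a` in depth `d + O(1)` and size
  `2^k · poly`, when each `Φ_a` is equivalent to `Φ'_a` on `≤ k` variables (or identically true).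

Here both are carried out for the tree's concrete system `textbookFrege` in the bounded-derivation
calculus `TextbookFrege.BD D B ℓ` of `FregeBounded.lean` (one-sided sequents `disjList`):

* `TextbookFrege.assump τ V`, `TextbookFrege.signed τ A` — the literals recording an assignment
  `τ` on the variables `V` (as sequent members: `¬x` if `τ x = true`, `x` otherwise) and a formula
  signed by its value;
* `TextbookFrege.evalS` — **truth-table evaluation**: `⊢ A^τ, assump τ V` for every formula `A`
  over `V`, in `|A| · O(|V|²)` lines of depth `depth(A) + O(1)` (the "ask all subformulas
  bottom-up" half of Lemma 4);
* `TextbookFrege.splitS` — **case analysis** over all assignments of `V` (`2^{|V|}` cuts; the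
  "ask the variables first" half of Lemma 4);
* `TextbookFrege.tautSeqS` — a tautological sequent over `k` variables has a bounded derivation of
  `2^k · poly` lines (Lemma 4 in sequent form);
* `TextbookFrege.transferS` — **Lemma 10 at clause level**: if `π` refutes (proves the negation
  of) the rendering of a clause list `T` after a substitution `σ`, and every substituted clause of
  `T` is implied by at most `q` clauses of a CNF `T'` on at most `k` variables jointly, then
  `¬ ofCNF T'` has a bounded derivation of depth `+ O(1)` and `2^k · poly` more lines;
  `transfer_isDepthProofOf` packages it with `IsProofOf.map_subst` as a statement about
  `textbookFrege.IsDepthProofOf` and `proofSize`.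

All statements are proved; nothing is cited as a fact. Line counts are explicit (crude)
polynomials.

## References

* [GalesiEtAl2023] N. Galesi, D. Itsykson, A. Riazanov, A. Sofronova, *Bounded-depth Frege
  complexity of Tseitin formulas for all graphs*, Ann. Pure Appl. Logic 174 (2023) 103166, §2
  (Lemma 2, Lemma 4, Cor. 5), §3.1 (Lemma 10). Read: APAL text pp. 7–11.
* J. R. Shoenfield, *Mathematical Logic* (1967), §3.1 (tautology theorem) — the connective rules
  used, as bounded in `FregeBounded.lean`.
-/

namespace Literature.Computability.MetaComplexity

open Complexity Complexity.PropForm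

namespace TextbookFrege

open KrajicekRamsey (litOf clauseOf ofCNF_eq_conjList subst_disjList subst_conjList size_subst_le
  altDepthAux_subst_le dd_clauseOf_le clauseExtractS)

variable {D B : ℕ}

/-! ### Assignments as sequent members -/

/-- The assumption literals of an assignment `τ` on the variable list `V`, as members of a
one-sided sequent: `¬x` when `τ x = true` (the sequent then reads "`x → ⋯`"), `x` when
`τ x = false`. [cite: GalesiEtAl2023, Lemma 4 (proof: "Pavel asks Sam x₁, …, x_k")] -/
def assump (τ : ℕ → Bool) (V : List ℕ) : List (PropForm ℕ) :=
  V.map fun x => if τ x then neg (var x) else var x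

/-- A formula signed by its value under `τ`: `A` if `A` is true under `τ`, `¬A` otherwise.
[cite: GalesiEtAl2023, Lemma 4 (proof: "asks all subformulas … starting with the deeper ones")] -/
def signed (τ : ℕ → Bool) (A : PropForm ℕ) : PropForm ℕ :=
  if A.eval τ then A else neg A

variable {τ : ℕ → Bool} {V : List ℕ}

/-- Length of the assumption list. [folklore] -/
@[simp] theorem length_assump (τ : ℕ → Bool) (V : List ℕ) : (assump τ V).length = V.length := by
  simp [assump]

/-- Unfolding `assump` on a cons. [folklore] -/
theorem assump_cons (τ : ℕ → Bool) (x : ℕ) (V : List ℕ) :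
    assump τ (x :: V) = (if τ x then neg (var x) else var x) :: assump τ V := rfl

/-- A true variable contributes `¬x`. [folklore] -/
theorem neg_var_mem_assump {x : ℕ} (hx : x ∈ V) (h : τ x = true) : neg (var x) ∈ assump τ V :=
  List.mem_map.2 ⟨x, hx, by simp [h]⟩

/-- A false variable contributes `x`. [folklore] -/
theorem var_mem_assump {x : ℕ} (hx : x ∈ V) (h : τ x = false) : var x ∈ assump τ V :=
  List.mem_map.2 ⟨x, hx, by simp [h]⟩

/-- Members of the assumption list are literals: size at most `2`. [folklore] -/
theorem size_le_of_mem_assump {X : PropForm ℕ} (h : X ∈ assump τ V) : X.size ≤ 2 := by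
  obtain ⟨x, -, rfl⟩ := List.mem_map.1 h
  split_ifs <;> simp [size]

/-- Members of the assumption list are literals: disjunct depth at most `1`. [folklore] -/
theorem dd_le_of_mem_assump {X : PropForm ℕ} (h : X ∈ assump τ V) : X.dd ≤ 1 := by
  obtain ⟨x, -, rfl⟩ := List.mem_map.1 h
  split_ifs <;> simp

/-- The member sum of the assumption list is at most `3 |V|`. [folklore] -/
theorem msum_assump_le (τ : ℕ → Bool) (V : List ℕ) : msum (assump τ V) ≤ 3 * V.length := by
  induction V with
  | nil => simp [assump]
  | cons x V ih =>
    rw [assump_cons, msum_cons, List.length_cons]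
    have : (if τ x then neg (var x) else var x).size ≤ 2 := by split_ifs <;> simp [size]
    omega

/-- The assumption literals are falsified by their assignment: `assump τ V` has no true member
under `τ`. [folklore] -/
theorem eval_eq_false_of_mem_assump {X : PropForm ℕ} (h : X ∈ assump τ V) : X.eval τ = false := by
  obtain ⟨x, -, rfl⟩ := List.mem_map.1 h
  cases hx : τ x <;> simp [eval, hx]

/-- Size of a signed formula. [folklore] -/
theorem size_signed_le (τ : ℕ → Bool) (A : PropForm ℕ) : (signed τ A).size ≤ A.size + 1 := by
  unfold signed; split_ifs <;> simp [size]

/-- Disjunct depth of a signed formula. [folklore] -/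
theorem dd_signed_le (τ : ℕ → Bool) (A : PropForm ℕ) : (signed τ A).dd ≤ A.altDepth + 1 := by
  unfold signed
  split_ifs
  · exact (dd_le_altDepth A).trans (Nat.le_succ _)
  · rw [dd_neg]; exact Nat.succ_le_succ (altDepthAux_le_altDepth' 1 A)

/-- A signed formula is true under its assignment. [folklore] -/
theorem eval_signed (τ : ℕ → Bool) (A : PropForm ℕ) : (signed τ A).eval τ = true := by
  unfold signed
  split_ifs with h
  · exact h
  · simpa [eval] using h

/-- Subformulas are no deeper than the formula: negation. [folklore] -/
theorem altDepth_le_altDepth_neg (A : PropForm ℕ) : A.altDepth ≤ (neg A).altDepth := by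
  have := altDepthAux_le_altDepthAux_succ 0 1 A
  simp only [altDepth, altDepthAux, show (0 : ℕ) ≠ 1 by decide, if_false] at this ⊢
  exact this

/-- Subformulas are no deeper than the formula: conjunction. [folklore] -/
theorem altDepth_le_altDepth_conj (A₁ A₂ : PropForm ℕ) :
    A₁.altDepth ≤ (conj A₁ A₂).altDepth ∧ A₂.altDepth ≤ (conj A₁ A₂).altDepth := by
  have h1 := altDepthAux_le_altDepthAux_succ 0 2 A₁
  have h2 := altDepthAux_le_altDepthAux_succ 0 2 A₂
  simp only [altDepth, altDepthAux, show (0 : ℕ) ≠ 2 by decide, if_false] at h1 h2 ⊢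
  omega

/-- Subformulas are no deeper than the formula: disjunction. [folklore] -/
theorem altDepth_le_altDepth_disj (A₁ A₂ : PropForm ℕ) :
    A₁.altDepth ≤ (disj A₁ A₂).altDepth ∧ A₂.altDepth ≤ (disj A₁ A₂).altDepth := by
  have h1 := altDepthAux_le_altDepthAux_succ 0 3 A₁
  have h2 := altDepthAux_le_altDepthAux_succ 0 3 A₂
  simp only [altDepth, altDepthAux, show (0 : ℕ) ≠ 3 by decide, if_false] at h1 h2 ⊢
  omega

/-- Quadratic bookkeeping for the structural steps of `evalS`. [folklore] -/
theorem evalS_arith (N : ℕ) : 50 * (N + 4) ^ 2 + 120 ≤ 100 * (N + 8) ^ 2 := by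
  have h1 : (N + 4) ^ 2 = N * N + 8 * N + 16 := by ring
  have h2 : (N + 8) ^ 2 = N * N + 16 * N + 64 := by ring
  rw [h1, h2]; omega

/-- Line bookkeeping: one more node pays for an overhead `M ≤ W`. [folklore] -/
theorem lines_arith₁ {a c M W : ℕ} (hM : M ≤ W) (hc : a + 1 ≤ c) : a * W + M ≤ c * W :=
  calc a * W + M ≤ a * W + W := by omega
    _ = (a + 1) * W := by ring
    _ ≤ c * W := Nat.mul_le_mul_right _ hc

/-- Line bookkeeping: one more node pays for an overhead `M ≤ W`, binary case. [folklore] -/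
theorem lines_arith₂ {a b c M W : ℕ} (hM : M ≤ W) (hc : a + b + 1 ≤ c) :
    a * W + b * W + M ≤ c * W :=
  calc a * W + b * W + M ≤ a * W + b * W + W := by omega
    _ = (a + b + 1) * W := by ring
    _ ≤ c * W := Nat.mul_le_mul_right _ hc

/-! ### Truth-table evaluation (GIRS Lemma 4, second half) -/

/-- **Truth-table evaluation derivations.** For an assignment `τ` on a list `V` of at most `N`
variables and a formula `A` over `V` of size `≤ s` and alternation depth `≤ q`, the sequent
`⊢ A^τ, assump τ V` ("under the assumptions recording `τ`, `A` has its value") has a bounded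
derivation with at most `|A| · 100 (N+8)²` lines, every line of disjunct depth `≤ q + 8` (given
`D ≥ q + 8`) and size `≤ B` (given `B ≥ 40 (s + N) + 200`). Proof by structural induction, one
connective rule of Shoenfield's tautology theorem per node (the "ask all subformulas starting with
the deeper ones" step of Pavel's strategy). [cite: GalesiEtAl2023, Lemma 4 (proof)] -/
theorem evalS (τ : ℕ → Bool) (V : List ℕ) {N q s : ℕ} (hN : V.length ≤ N) (hD : q + 8 ≤ D)
    (hB : 40 * (s + N) + 200 ≤ B) :
    ∀ A : PropForm ℕ, A.size ≤ s → A.altDepth ≤ q → (∀ x ∈ A.vars, x ∈ V) →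
      BD D B (A.size * (100 * (N + 8) ^ 2)) (disjList (signed τ A :: assump τ V)) := by
  have harith := evalS_arith N
  have hmsum := msum_assump_le τ V
  have hLdd : (disjList (assump τ V)).dd ≤ 1 := dd_disjList_le fun X hX => dd_le_of_mem_assump hX
  have hnLdd : (neg (disjList (assump τ V))).dd ≤ 3 :=
    dd_neg_disjList_le (p := 1) fun X hX => dd_le_of_mem_assump hX
  have hLsize : (disjList (assump τ V)).size ≤ 3 * N + 1 := by
    rw [size_disjList_eq_msum]; omega
  -- the generic structural step: from `⊢ L` to `⊢ L'` when `L ⊆ L'`, both short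
  have struct : ∀ {ℓ : ℕ} {L L' : List (PropForm ℕ)}, BD D B ℓ (disjList L) →
      (∀ X ∈ L, X ∈ L') → (∀ X ∈ L', X.dd ≤ q + 1) → L.length ≤ N + 3 → L'.length ≤ N + 3 →
      msum L ≤ 2 * s + 3 * N + 4 → msum L' ≤ 2 * s + 3 * N + 6 →
      BD D B (ℓ + 50 * (N + 4) ^ 2) (disjList L') := by
    intro ℓ L L' h hsub hp hlen hlen' hm hm'
    refine subsetN (N := N + 3) h hsub hp (by omega) ?_ hlen hlen'
    rw [size_disjList_eq_msum, size_disjList_eq_msum]; omega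
  -- members of the context
  have hctx : ∀ X ∈ assump τ V, X.dd ≤ q + 1 := fun X hX => (dd_le_of_mem_assump hX).trans (by omega)
  intro A
  induction A with
  | var x =>
    intro hs _ hv
    have hs1 : 1 ≤ s := by simpa [size] using hs
    have hx : x ∈ V := hv x (by simp [PropForm.vars])
    have hax : BD D B 12 (disjList [neg (var x), var x]) :=
      axS (var x) (by simp; omega) (by simp only [size]; omega)
    have hgoal : ∀ X ∈ [neg (var x), var x], X ∈ signed τ (var x) :: assump τ V := by
      intro X hX
      simp only [List.mem_cons, List.not_mem_nil, or_false] at hX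
      unfold signed
      rcases hX with rfl | rfl
      · cases hτ : τ x
        · simp [eval, hτ]
        · exact List.mem_cons_of_mem _ (neg_var_mem_assump hx hτ)
      · cases hτ : τ x
        · exact List.mem_cons_of_mem _ (var_mem_assump hx hτ)
        · simp [eval, hτ]
    refine (struct hax hgoal ?_ (by simp) (by simp; omega) (by simp [size]; omega) ?_).mono ?_
    · intro X hX
      rcases List.mem_cons.1 hX with rfl | hX
      · unfold signed; split_ifs <;> simp
      · exact hctx X hX
    · rw [msum_cons]
      have := size_signed_le τ (var x)
      simp only [size] at this; omega
    · simp only [size]; omega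
  | const b =>
    intro _ _ _
    cases b
    · -- `⊥` is false: derive `⊢ ¬⊥, assump`
      have h0 : BD D B (1 + 3) (disjList [neg (const false)]) :=
        unitS (negBotB (by omega) (by omega)) (by omega) (by simp only [size]; omega)
      have hsg : signed τ (const false) = neg (const false) := by simp [signed, eval]
      rw [hsg]
      refine (struct h0 (by simp) ?_ (by simp) (by simp; omega) (by simp [size]) ?_).mono ?_
      · intro X hX
        rcases List.mem_cons.1 hX with rfl | hX
        · simp
        · exact hctx X hX
      · rw [msum_cons]; simp only [size]; omega
      · simp only [size]; omega
    · have h0 : BD D B 4 (disjList [const true]) := topS (by omega) (by omega)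
      have hsg : signed τ (const true) = const true := by simp [signed, eval]
      rw [hsg]
      refine (struct h0 (by simp) ?_ (by simp) (by simp; omega) (by simp [size]) ?_).mono ?_
      · intro X hX
        rcases List.mem_cons.1 hX with rfl | hX
        · simp
        · exact hctx X hX
      · rw [msum_cons]; simp only [size]; omega
      · simp only [size]; omega
  | neg A ih =>
    intro hs hq hv
    have hqA : A.altDepth ≤ q := (altDepth_le_altDepth_neg A).trans hq
    have hsA : A.size ≤ s := by simp only [size] at hs; omega
    have ih' := ih hsA hqA (fun x hx => hv x (by simpa [PropForm.vars] using hx))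
    have hddA : (neg A).dd ≤ q + 1 := by
      rw [dd_neg]; exact Nat.succ_le_succ ((altDepthAux_le_altDepth' 1 A).trans hqA)
    cases hA : A.eval τ
    · -- `A` false: `A^τ = ¬A = (¬A)^τ`
      have h1 : signed τ A = neg A := by simp [signed, hA]
      have h2 : signed τ (neg A) = neg A := by simp [signed, eval, hA]
      rw [h2]; rw [h1] at ih'
      exact ih'.mono (Nat.mul_le_mul_right _ (by simp only [size]; omega))
    · -- `A` true: `(¬A)^τ = ¬¬A`
      have h1 : signed τ A = A := by simp [signed, hA]
      have h2 : signed τ (neg A) = neg (neg A) := by simp [signed, eval, hA]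
      rw [h2]; rw [h1] at ih'
      refine (consNegNegS ih' (by omega) (by omega) ?_).mono ?_
      · rw [size_disjList_cons]; omega
      · exact lines_arith₁ (by omega) (by simp only [size]; omega)
  | conj A₁ A₂ ih₁ ih₂ =>
    intro hs hq hv
    have hq₁ : A₁.altDepth ≤ q := (altDepth_le_altDepth_conj A₁ A₂).1.trans hq
    have hq₂ : A₂.altDepth ≤ q := (altDepth_le_altDepth_conj A₁ A₂).2.trans hq
    have hs₁ : A₁.size ≤ s := by simp only [size] at hs; omega
    have hs₂ : A₂.size ≤ s := by simp only [size] at hs; omega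
    have hs₁₂ : A₁.size + A₂.size + 1 ≤ s := by simpa only [size] using hs
    have ih₁' := ih₁ hs₁ hq₁ (fun x hx => hv x (by simp [PropForm.vars, hx]))
    have ih₂' := ih₂ hs₂ hq₂ (fun x hx => hv x (by simp [PropForm.vars, hx]))
    have hd₁ : A₁.dd ≤ q := (dd_le_altDepth A₁).trans hq₁
    have hd₂ : A₂.dd ≤ q := (dd_le_altDepth A₂).trans hq₂
    have hdn₁ : (neg A₁).dd ≤ q + 1 := by
      rw [dd_neg]; exact Nat.succ_le_succ ((altDepthAux_le_altDepth' 1 A₁).trans hq₁)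
    have hdn₂ : (neg A₂).dd ≤ q + 1 := by
      rw [dd_neg]; exact Nat.succ_le_succ ((altDepthAux_le_altDepth' 1 A₂).trans hq₂)
    cases hA₁ : A₁.eval τ
    · -- `A₁` false: `⊢ ¬A₁, L` ⟹ `⊢ ¬A₁, ¬A₂, L` ⟹ `⊢ ¬(A₁ ∧ A₂), L`
      have h1 : signed τ A₁ = neg A₁ := by simp [signed, hA₁]
      have h2 : signed τ (conj A₁ A₂) = neg (conj A₁ A₂) := by simp [signed, eval, hA₁]
      rw [h2]; rw [h1] at ih₁'
      have h3 : BD D B (A₁.size * (100 * (N + 8) ^ 2) + 50 * (N + 4) ^ 2)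
          (disjList (neg A₁ :: neg A₂ :: assump τ V)) := by
        refine struct ih₁' (fun X hX => ?_) (fun X hX => ?_) (by simp; omega) (by simp; omega) ?_ ?_
        · rcases List.mem_cons.1 hX with rfl | hX
          · simp
          · simp [hX]
        · simp only [List.mem_cons] at hX
          rcases hX with rfl | rfl | hX
          · exact hdn₁
          · exact hdn₂
          · exact hctx X hX
        · rw [msum_cons]; simp only [size]; omega
        · rw [msum_cons, msum_cons]; simp only [size]; omega
      refine (consNegConjS h3 (by omega) (by omega) (by omega) ?_).mono ?_
      · omega
      · rw [Nat.add_assoc]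
        exact lines_arith₁ (by omega) (by simp only [size]; omega)
    · cases hA₂ : A₂.eval τ
      · -- `A₂` false
        have h1 : signed τ A₂ = neg A₂ := by simp [signed, hA₂]
        have h2 : signed τ (conj A₁ A₂) = neg (conj A₁ A₂) := by simp [signed, eval, hA₂]
        rw [h2]; rw [h1] at ih₂'
        have h3 : BD D B (A₂.size * (100 * (N + 8) ^ 2) + 50 * (N + 4) ^ 2)
            (disjList (neg A₁ :: neg A₂ :: assump τ V)) := by
          refine struct ih₂' (fun X hX => ?_) (fun X hX => ?_) (by simp; omega) (by simp; omega)
            ?_ ?_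
          · rcases List.mem_cons.1 hX with rfl | hX
            · simp
            · simp [hX]
          · simp only [List.mem_cons] at hX
            rcases hX with rfl | rfl | hX
            · exact hdn₁
            · exact hdn₂
            · exact hctx X hX
          · rw [msum_cons]; simp only [size]; omega
          · rw [msum_cons, msum_cons]; simp only [size]; omega
        refine (consNegConjS h3 (by omega) (by omega) (by omega) ?_).mono ?_
        · omega
        · rw [Nat.add_assoc]
          exact lines_arith₁ (by omega) (by simp only [size]; omega)
      · -- both true: `⊢ A₁ ∧ A₂, L`
        have h1 : signed τ A₁ = A₁ := by simp [signed, hA₁]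
        have h1' : signed τ A₂ = A₂ := by simp [signed, hA₂]
        have h2 : signed τ (conj A₁ A₂) = conj A₁ A₂ := by simp [signed, eval, hA₁, hA₂]
        rw [h2]; rw [h1] at ih₁'; rw [h1'] at ih₂'
        refine (consConjS ih₁' ih₂' (by omega) (by omega) (by omega) ?_).mono ?_
        · omega
        · exact lines_arith₂ (by omega) (by simp only [size]; omega)
  | disj A₁ A₂ ih₁ ih₂ =>
    intro hs hq hv
    have hq₁ : A₁.altDepth ≤ q := (altDepth_le_altDepth_disj A₁ A₂).1.trans hq
    have hq₂ : A₂.altDepth ≤ q := (altDepth_le_altDepth_disj A₁ A₂).2.trans hq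
    have hs₁ : A₁.size ≤ s := by simp only [size] at hs; omega
    have hs₂ : A₂.size ≤ s := by simp only [size] at hs; omega
    have hs₁₂ : A₁.size + A₂.size + 1 ≤ s := by simpa only [size] using hs
    have ih₁' := ih₁ hs₁ hq₁ (fun x hx => hv x (by simp [PropForm.vars, hx]))
    have ih₂' := ih₂ hs₂ hq₂ (fun x hx => hv x (by simp [PropForm.vars, hx]))
    have hd₁ : A₁.dd ≤ q := (dd_le_altDepth A₁).trans hq₁
    have hd₂ : A₂.dd ≤ q := (dd_le_altDepth A₂).trans hq₂
    -- the common step for a true disjunct: `⊢ Aᵢ, L` ⟹ `⊢ A₁, A₂, L` ⟹ `⊢ A₁ ∨ A₂, L`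
    have viaTrue : ∀ {ℓ : ℕ} {X : PropForm ℕ}, (X = A₁ ∨ X = A₂) →
        BD D B ℓ (disjList (X :: assump τ V)) → X.size ≤ s →
        BD D B (ℓ + 50 * (N + 4) ^ 2 + 1) (disjList (disj A₁ A₂ :: assump τ V)) := by
      intro ℓ X hX h hXs
      have h3 : BD D B (ℓ + 50 * (N + 4) ^ 2) (disjList (A₁ :: A₂ :: assump τ V)) := by
        refine struct h (fun Y hY => ?_) (fun Y hY => ?_) (by simp; omega) (by simp; omega) ?_ ?_
        · rcases List.mem_cons.1 hY with rfl | hY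
          · rcases hX with rfl | rfl <;> simp
          · simp [hY]
        · simp only [List.mem_cons] at hY
          rcases hY with rfl | rfl | hY
          · omega
          · omega
          · exact hctx Y hY
        · rw [msum_cons]; omega
        · rw [msum_cons, msum_cons]; omega
      exact consDisjS h3
    cases hA₁ : A₁.eval τ
    · cases hA₂ : A₂.eval τ
      · -- both false: `⊢ ¬(A₁ ∨ A₂), L`
        have h1 : signed τ A₁ = neg A₁ := by simp [signed, hA₁]
        have h1' : signed τ A₂ = neg A₂ := by simp [signed, hA₂]
        have h2 : signed τ (disj A₁ A₂) = neg (disj A₁ A₂) := by simp [signed, eval, hA₁, hA₂]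
        rw [h2]; rw [h1] at ih₁'; rw [h1'] at ih₂'
        refine (consNegDisjS ih₁' ih₂' (by omega) (by omega) (by omega) ?_).mono ?_
        · omega
        · exact lines_arith₂ (by omega) (by simp only [size]; omega)
      · -- `A₂` true
        have h1 : signed τ A₂ = A₂ := by simp [signed, hA₂]
        have h2 : signed τ (disj A₁ A₂) = disj A₁ A₂ := by simp [signed, eval, hA₂]
        rw [h2]; rw [h1] at ih₂'
        refine (viaTrue (Or.inr rfl) ih₂' hs₂).mono ?_
        rw [Nat.add_assoc]
        exact lines_arith₁ (by omega) (by simp only [size]; omega)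
    · -- `A₁` true
      have h1 : signed τ A₁ = A₁ := by simp [signed, hA₁]
      have h2 : signed τ (disj A₁ A₂) = disj A₁ A₂ := by simp [signed, eval, hA₁]
      rw [h2]; rw [h1] at ih₁'
      refine (viaTrue (Or.inl rfl) ih₁' hs₁).mono ?_
      rw [Nat.add_assoc]
      exact lines_arith₁ (by omega) (by simp only [size]; omega)

/-! ### Case analysis over the assignments of a variable list (GIRS Lemma 4, first half) -/

/-- Assumption lists only depend on the values of the listed variables. [folklore] -/
theorem assump_congr {τ τ' : ℕ → Bool} {V : List ℕ} (h : ∀ y ∈ V, τ y = τ' y) :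
    assump τ V = assump τ' V :=
  List.map_congr_left fun y hy => by rw [h y hy]

/-- **Case analysis over all assignments.** If `⊢ assump τ V, Γ` for every assignment `τ` of the
(duplicate-free) variable list `V`, each in `≤ m` lines, then `⊢ Γ` in `≤ 2^{|V|} (m + 2)` lines:
cut on the variables one after the other (Pavel "asks Sam `x₁, …, x_k`; there are `2^k` possible
combinations of Sam's answers"). [cite: GalesiEtAl2023, Lemma 4 (proof)] -/
theorem splitS (Γ : List (PropForm ℕ)) :
    ∀ (V : List ℕ) {m : ℕ}, V.Nodup → 2 * (3 * V.length + msum Γ + 1) + 1 ≤ B →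
      (∀ τ : ℕ → Bool, BD D B m (disjList (assump τ V ++ Γ))) →
      BD D B (2 ^ V.length * (m + 2)) (disjList Γ) := by
  intro V
  induction V with
  | nil =>
    intro m _ _ h
    simpa [assump] using (h fun _ => false).mono (by simp)
  | cons x V ih =>
    intro m hnd hs h
    rw [List.nodup_cons] at hnd
    rw [List.length_cons] at hs
    have step : ∀ τ : ℕ → Bool, BD D B (m + m + 2) (disjList (assump τ V ++ Γ)) := by
      intro τ
      have hne : ∀ y ∈ V, y ≠ x := fun y hy h => hnd.1 (h ▸ hy)
      have e0 : assump (Function.update τ x false) V = assump τ V :=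
        assump_congr fun y hy => Function.update_of_ne (hne y hy) _ _
      have e1 : assump (Function.update τ x true) V = assump τ V :=
        assump_congr fun y hy => Function.update_of_ne (hne y hy) _ _
      have h0 := h (Function.update τ x false)
      have h1 := h (Function.update τ x true)
      rw [assump_cons, Function.update_self, e0] at h0
      rw [assump_cons, Function.update_self, e1] at h1
      simp only [Bool.false_eq_true, if_false, if_true, List.cons_append] at h0 h1
      refine cutS h0 h1 ?_
      rw [size_disjList_eq_msum, msum_append]
      have := msum_assump_le τ V
      omega
    have := ih hnd.2 (by omega) step
    refine this.mono ?_
    rw [List.length_cons, Nat.pow_succ]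
    nlinarith [Nat.one_le_two_pow (n := V.length)]

/-- The line count of `tautSeqS`: `2^N · (S₀ · 100 (N+8)² + 50 (2N+3)² + 2)`. [folklore] -/
def tautLines (N S₀ : ℕ) : ℕ :=
  2 ^ N * (S₀ * (100 * (N + 8) ^ 2) + 50 * (2 * N + 3) ^ 2 + 2)

/-- `tautLines` is monotone in the variable budget. [folklore] -/
theorem tautLines_mono_left {N N' S₀ : ℕ} (h : N ≤ N') : tautLines N S₀ ≤ tautLines N' S₀ := by
  unfold tautLines
  gcongr
  norm_num

/-- **A tautological sequent over few variables has a short bounded derivation** (GIRS Lemma 4 in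
sequent form): if every assignment makes some member of `Γ` true, the members of `Γ` mention only
the `≤ N` variables of `V`, have alternation depth `≤ q` and `msum Γ ≤ S₀`, then `⊢ Γ` has a
bounded derivation with `≤ tautLines N S₀` lines of disjunct depth `≤ q + 8` and size
`≤ 40 (S₀ + N) + 200`: case analysis over the `2^{|V|}` assignments (`splitS`), each case closed
by evaluating a true member (`evalS`). [cite: GalesiEtAl2023, Lemma 4] -/
theorem tautSeqS (Γ : List (PropForm ℕ)) (V : List ℕ) (hV : V.Nodup) {N q S₀ : ℕ}
    (hN : V.length ≤ N) (hΓN : Γ.length ≤ N) (hvars : ∀ A ∈ Γ, ∀ x ∈ A.vars, x ∈ V)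
    (htaut : ∀ τ : ℕ → Bool, ∃ A ∈ Γ, A.eval τ = true) (hq : ∀ A ∈ Γ, A.altDepth ≤ q)
    (hS : msum Γ ≤ S₀) (hD : q + 8 ≤ D) (hB : 40 * (S₀ + N) + 200 ≤ B) :
    BD D B (tautLines N S₀) (disjList Γ) := by
  have hsize : ∀ A ∈ Γ, A.size ≤ S₀ := fun A hA => (size_lt_msum hA).le.trans hS
  -- one case
  have hcase : ∀ τ : ℕ → Bool,
      BD D B (S₀ * (100 * (N + 8) ^ 2) + 50 * (2 * N + 3) ^ 2) (disjList (assump τ V ++ Γ)) := by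
    intro τ
    obtain ⟨A, hA, hAτ⟩ := htaut τ
    have h1 := evalS τ V hN hD hB A (hsize A hA) (hq A hA) (hvars A hA)
    have hsg : signed τ A = A := by simp [signed, hAτ]
    rw [hsg] at h1
    have hmsV := msum_assump_le τ V
    refine (subsetN (N := 2 * N + 2) (L' := assump τ V ++ Γ) h1 ?_ (p := q + 1) ?_ (by omega) ?_
      (by simp; omega) (by simp; omega)).mono ?_
    · intro X hX
      rcases List.mem_cons.1 hX with rfl | hX
      · exact List.mem_append_right _ hA
      · exact List.mem_append_left _ hX
    · intro X hX
      rcases List.mem_append.1 hX with hX | hX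
      · exact (dd_le_of_mem_assump hX).trans (by omega)
      · exact (dd_le_altDepth X).trans ((hq X hX).trans (by omega))
    · rw [size_disjList_eq_msum, size_disjList_eq_msum, msum_cons, msum_append]
      have := hsize A hA
      omega
    · have : A.size * (100 * (N + 8) ^ 2) ≤ S₀ * (100 * (N + 8) ^ 2) :=
        Nat.mul_le_mul_right _ (hsize A hA)
      have e : 2 * N + 2 + 1 = 2 * N + 3 := by omega
      rw [e]; omega
  have hsplit := splitS Γ V hV (by omega) hcase
  refine hsplit.mono ?_
  unfold tautLines
  exact Nat.mul_le_mul_right _ (Nat.pow_le_pow_right (by norm_num) hN)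

/-- `msum` of a list whose members have size `< W` is at most `|L| · W`. [folklore] -/
theorem msum_le_length_mul {L : List (PropForm ℕ)} {W : ℕ} (h : ∀ X ∈ L, X.size + 1 ≤ W) :
    msum L ≤ L.length * W := by
  induction L with
  | nil => simp
  | cons X L ih =>
    rw [msum_cons, List.length_cons]
    have h1 := h X List.mem_cons_self
    have h2 := ih fun Y hY => h Y (List.mem_cons_of_mem _ hY)
    nlinarith

/-! ### Transfer of a refutation along a substitution (GIRS Lemma 10 at clause level) -/

/-- A rendered clause has alternation depth at most `2`. [folklore] -/
theorem altDepth_clauseOf_le (c : Clause ℕ) : (clauseOf c).altDepth ≤ 2 :=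
  (altDepth_le_dd_succ _).trans (by have := dd_clauseOf_le c; omega)

/-- A negated rendered clause has alternation depth at most `3`. [folklore] -/
theorem altDepth_neg_clauseOf_le (c : Clause ℕ) : (neg (clauseOf c)).altDepth ≤ 3 := by
  have h1 := altDepthAux_le_dd_succ 1 (clauseOf c)
  have h2 := dd_clauseOf_le c
  simp only [altDepth, altDepthAux, show (0 : ℕ) ≠ 1 by decide, if_false]
  omega

/-- A negated rendered clause has disjunct depth at most `3`. [folklore] -/
theorem dd_neg_clauseOf_le (c : Clause ℕ) : (neg (clauseOf c)).dd ≤ 3 := by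
  rw [dd_neg]
  have h1 := altDepthAux_le_dd_succ 1 (clauseOf c)
  have h2 := dd_clauseOf_le c
  omega

/-- The per-clause line count of `transferS` (evaluation of one substituted source clause against
its `≤ qq` implying target clauses on `≤ k` variables, plus their extraction). [folklore] -/
def transferClauseLines (Z qq k : ℕ) : ℕ :=
  tautLines (k + qq + 1) ((qq + 1) * (Z + 2)) + 50 * (qq + 4) ^ 2 +
    qq * (130 * (Z + 3) + 50 * (qq + 4) ^ 2 + 8)

/-- The line count of `transferS`. [folklore] -/
def transferLines (ℓ₀ Z qq k : ℕ) : ℕ :=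
  ℓ₀ + Z * (transferClauseLines Z qq k + 51) + 2300

/-- Final line bookkeeping of `transferS`. [folklore] -/
theorem transferLines_arith {a Z l M : ℕ} (h : a ≤ Z) :
    4 + 50 * (5 + 1) ^ 2 + a * (M + 51) + (l + 3 + 50 * (2 + 1) ^ 2) + 2 + 8 ≤
      l + Z * (M + 51) + 2300 := by
  have := Nat.mul_le_mul_right (M + 51) h
  omega

/-- **Transfer of a refutation** (GIRS Lemma 10, clause level, for `textbookFrege`). Let `Ds` be a
list of formulas (the substituted clauses of a source CNF) with a bounded derivation of `¬ ⋀ Ds`,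
and let `T'` be a CNF such that every `D ∈ Ds` is semantically implied by at most `qq` clauses of
`T'` which, together with `D`, mention at most `k` variables. Then `¬ ofCNF T'` has a bounded
derivation: for each `D`, the tautological sequent `⊢ D, ¬C₁, …, ¬C_q` (`tautSeqS`, `2^k · poly`
lines) is cut against the clause extractions `⊢ ¬ ofCNF T', Cᵢ`; conjunction introduction gives
`⊢ ⋀ Ds, ¬ ofCNF T'`, and a final cut against `¬ ⋀ Ds` concludes. Depth grows by a constant
(`D ≥ q + 12` where `q ≥ 3` bounds the alternation depth of the `D`s); `Z` bounds `msum Ds` and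
`msum` of the rendered clauses of `T'`. [cite: GalesiEtAl2023, Lemma 10] -/
theorem transferS {ℓ₀ q Z qq k : ℕ} (Ds : List (PropForm ℕ)) (T' : CNF ℕ)
    (h₀ : BD D B ℓ₀ (neg (conjList Ds)))
    (hq : ∀ Dj ∈ Ds, Dj.altDepth ≤ q) (hq3 : 3 ≤ q)
    (hZ : msum Ds ≤ Z) (hZ' : msum (T'.map clauseOf) ≤ Z)
    (hloc : ∀ Dj ∈ Ds, ∃ (Lc : List (Clause ℕ)) (V : List ℕ), (∀ C ∈ Lc, C ∈ T') ∧
      Lc.length ≤ qq ∧ V.Nodup ∧ V.length ≤ k ∧ (∀ x ∈ Dj.vars, x ∈ V) ∧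
      (∀ C ∈ Lc, ∀ x ∈ (clauseOf C).vars, x ∈ V) ∧
      ∀ τ : ℕ → Bool, (∀ C ∈ Lc, (clauseOf C).eval τ = true) → Dj.eval τ = true)
    (hD : q + 12 ≤ D) (hB : 40 * ((qq + 3) * (Z + 3) + k) + 300 ≤ B) :
    BD D B (transferLines ℓ₀ Z qq k) (neg (PropForm.ofCNF T')) := by
  set R' := PropForm.ofCNF T' with hR'def
  have hR' : R' = conjList (T'.map clauseOf) := ofCNF_eq_conjList T'
  -- depth and size facts
  have hddR' : R'.dd ≤ 3 := KrajicekRamsey.dd_ofCNF_le T'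
  have hddnR' : (neg R').dd ≤ 4 := KrajicekRamsey.dd_neg_ofCNF_le T'
  have hszR' : R'.size ≤ Z + 1 := by rw [hR', size_conjList_eq_msum]; omega
  have hddDs : ∀ X ∈ Ds, X.dd ≤ q := fun X hX => (dd_le_altDepth X).trans (hq X hX)
  have hddC : (conjList Ds).dd ≤ q + 2 := dd_conjList_le hddDs
  have hddnC : (neg (conjList Ds)).dd ≤ q + 3 := dd_neg_conjList_le hddDs
  have hszC : (conjList Ds).size ≤ Z + 1 := by rw [size_conjList_eq_msum]; omega
  have hlenDs : Ds.length ≤ Z := (length_le_msum Ds).trans hZ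
  have hszCl : ∀ C ∈ T', (clauseOf C).size + 1 ≤ Z := fun C hC =>
    (size_lt_msum (List.mem_map.2 ⟨C, hC, rfl⟩)).trans_le hZ'
  have hprod : (qq + 3) * (Z + 3) = qq * (Z + 2) + qq + 3 * Z + 9 := by ring
  have hprod2 : (qq + 1) * (Z + 2) = qq * (Z + 2) + Z + 2 := by ring
  rw [hprod] at hB
  have hB16 : 16 * (Z + 3) ≤ B := by omega
  -- Step 1: `⊢ Dj, ¬R'` for every substituted clause
  have step1 : ∀ Dj ∈ Ds, BD D B (transferClauseLines Z qq k) (disjList [Dj, neg R']) := by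
    intro Dj hDj
    obtain ⟨Lc, V, hLc, hqq, hV, hk, hvD, hvC, himp⟩ := hloc Dj hDj
    have hszDj : Dj.size + 1 ≤ Z := (size_lt_msum hDj).trans_le hZ
    set NC := Lc.map fun C => neg (clauseOf C) with hNC
    have hlenNC : NC.length ≤ qq := by rw [hNC, List.length_map]; exact hqq
    have hmemNC : ∀ X ∈ NC, ∃ C ∈ Lc, X = neg (clauseOf C) := fun X hX => by
      obtain ⟨C, hC, rfl⟩ := List.mem_map.1 hX; exact ⟨C, hC, rfl⟩
    have hmsNC : msum NC ≤ qq * (Z + 2) := by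
      have h1 : msum NC ≤ NC.length * (Z + 2) := by
        refine msum_le_length_mul fun X hX => ?_
        obtain ⟨C, hC, rfl⟩ := hmemNC X hX
        have := hszCl C (hLc C hC)
        simp only [size]; omega
      exact h1.trans (Nat.mul_le_mul_right _ hlenNC)
    have hddNC : ∀ X ∈ NC, X.dd ≤ 3 := fun X hX => by
      obtain ⟨C, -, rfl⟩ := hmemNC X hX; exact dd_neg_clauseOf_le C
    -- (1a) the tautological sequent `⊢ Dj, ¬C₁, …, ¬C_q`
    have h1a : BD D B (tautLines (k + qq + 1) ((qq + 1) * (Z + 2))) (disjList (Dj :: NC)) := by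
      refine tautSeqS (Dj :: NC) V hV (q := q) (by omega) ?_ ?_ ?_ ?_ ?_ (by omega) ?_
      · rw [List.length_cons]; omega
      · intro A hA
        rcases List.mem_cons.1 hA with rfl | hA
        · exact hvD
        · obtain ⟨C, hC, rfl⟩ := hmemNC A hA
          intro x hx
          exact hvC C hC x (by simpa [PropForm.vars] using hx)
      · intro τ
        by_cases hall : ∀ C ∈ Lc, (clauseOf C).eval τ = true
        · exact ⟨Dj, List.mem_cons_self, himp τ hall⟩
        · push Not at hall
          obtain ⟨C, hC, hCτ⟩ := hall
          refine ⟨neg (clauseOf C), List.mem_cons_of_mem _ (List.mem_map.2 ⟨C, hC, rfl⟩), ?_⟩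
          simpa [eval] using hCτ
      · intro A hA
        rcases List.mem_cons.1 hA with rfl | hA
        · exact hq _ hDj
        · obtain ⟨C, -, rfl⟩ := hmemNC A hA
          exact (altDepth_neg_clauseOf_le C).trans hq3
      · rw [msum_cons, hprod2]; omega
      · rw [hprod2]; omega
    -- (1b) reorder to `⊢ ¬C₁, …, ¬C_q, Dj, ¬R'`
    have hctx : ∀ X ∈ NC ++ [Dj, neg R'], X.dd ≤ q + 3 := by
      intro X hX
      simp only [List.mem_append, List.mem_cons, List.not_mem_nil, or_false] at hX
      rcases hX with hX | rfl | rfl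
      · exact (hddNC X hX).trans (by omega)
      · exact (hddDs X hDj).trans (by omega)
      · omega
    have h1b : BD D B (tautLines (k + qq + 1) ((qq + 1) * (Z + 2)) + 50 * (qq + 3 + 1) ^ 2)
        (disjList (NC ++ [Dj, neg R'])) := by
      refine subsetN (N := qq + 3) h1a ?_ hctx (by omega) ?_ (by rw [List.length_cons]; omega)
        (by rw [List.length_append]; simp; omega)
      · intro X hX
        rcases List.mem_cons.1 hX with rfl | hX
        · simp
        · exact List.mem_append_left _ hX
      · rw [size_disjList_eq_msum, size_disjList_eq_msum, msum_cons, msum_append, msum_cons,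
          msum_cons, msum_nil]
        simp only [size]
        omega
    -- (1c) cut the `¬Cᵢ` away against the clause extractions
    have h1c := elimAllS NC (L := [Dj, neg R']) (m := 130 * (Z + 3) + 50 * (qq + 3 + 1) ^ 2 + 6)
      h1b ?_ ?_
    rotate_left
    · intro X hX K hK
      obtain ⟨C, hC, rfl⟩ := hmemNC X hX
      have hex : BD D B (130 * (Z + 3)) (disjList [neg R', clauseOf C]) :=
        clauseExtractS (hLc C hC) (by omega) (by omega) hB16
      have hKlen : K.length ≤ qq := (hK.length_le).trans hlenNC
      have hKsub : ∀ Y ∈ K, Y ∈ NC := fun Y hY => hK.subset hY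
      have hmsK : msum K ≤ qq * (Z + 2) := (msum_le_of_sublist hK.sublist).trans hmsNC
      have h2 : BD D B (130 * (Z + 3) + 50 * (qq + 3 + 1) ^ 2)
          (disjList (clauseOf C :: (K ++ [Dj, neg R']))) := by
        refine subsetN (N := qq + 3) hex ?_ ?_ (p := q + 3) (by omega) ?_ (by simp)
          (by rw [List.length_cons, List.length_append]; simp; omega)
        · intro Y hY
          simp only [List.mem_cons, List.not_mem_nil, or_false] at hY
          rcases hY with rfl | rfl
          · exact List.mem_cons_of_mem _ (List.mem_append_right _ (by simp))
          · exact List.mem_cons_self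
        · intro Y hY
          rcases List.mem_cons.1 hY with rfl | hY
          · exact (dd_clauseOf_le C).trans (by omega)
          · exact hctx Y (by
              rcases List.mem_append.1 hY with hY | hY
              · exact List.mem_append_left _ (hKsub Y hY)
              · exact List.mem_append_right _ hY)
        · have := hszCl C (hLc C hC)
          simp only [size_disjList_eq_msum, msum_cons, msum_append, msum_nil, size]
          omega
      have hLdd : (neg (disjList (K ++ [Dj, neg R']))).dd ≤ q + 5 :=
        dd_neg_disjList_le (p := q + 3) fun Y hY => hctx Y (by
          rcases List.mem_append.1 hY with hY | hY
          · exact List.mem_append_left _ (hKsub Y hY)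
          · exact List.mem_append_right _ hY)
      refine consNegNegS h2 ((dd_neg_clauseOf_le C).trans (by omega)) (hLdd.trans (by omega)) ?_
      have := hszCl C (hLc C hC)
      rw [size_disjList_eq_msum, msum_cons, msum_append]
      simp only [msum_cons, msum_nil, size]
      omega
    · rw [size_disjList_eq_msum, msum_append]
      simp only [msum_cons, msum_nil, size]
      omega
    refine h1c.mono ?_
    unfold transferClauseLines
    have e : qq + 3 + 1 = qq + 4 := by omega
    rw [e]
    have : NC.length * (130 * (Z + 3) + 50 * (qq + 4) ^ 2 + 6 + 2) ≤
        qq * (130 * (Z + 3) + 50 * (qq + 4) ^ 2 + 8) := Nat.mul_le_mul_right _ hlenNC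
    omega
  -- Step 2: `⊢ ⋀ Ds, ¬R'`
  have step2 : BD D B (4 + 50 * (5 + 1) ^ 2 + Ds.length * (transferClauseLines Z qq k + 51))
      (disjList (conjList Ds :: [neg R'])) := by
    refine conjIntroAllS Ds (fun A hA => step1 A hA) (p := q + 3) ?_ (by omega) (by simp) ?_
    · intro X hX
      rcases List.mem_append.1 hX with hX | hX
      · exact (hddDs X hX).trans (by omega)
      · simp only [List.mem_cons, List.not_mem_nil, or_false] at hX
        subst hX; omega
    · rw [msum_append]; simp only [msum_cons, msum_nil, size]; omega
  -- Step 3: cut against `¬ ⋀ Ds`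
  have h3a : BD D B (ℓ₀ + 3) (disjList [neg (conjList Ds)]) :=
    unitS h₀ (by omega) (by simp only [size]; omega)
  have h3b : BD D B (ℓ₀ + 3 + 50 * (2 + 1) ^ 2) (disjList (neg (conjList Ds) :: [neg R'])) := by
    refine subsetN (N := 2) h3a (by simp) (p := q + 3) ?_ (by omega) ?_ (by simp) (by simp)
    · intro X hX
      simp only [List.mem_cons, List.not_mem_nil, or_false] at hX
      rcases hX with rfl | rfl
      · exact hddnC
      · omega
    · simp only [size_disjList_cons, size_disjList_nil, size]; omega
  have h3c := cutS step2 h3b (by simp only [size_disjList_cons, size_disjList_nil, size]; omega)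
  have e1 : disjList [neg R'] = disj (neg R') (const false) := rfl
  rw [e1] at h3c
  have h3d := removeBotB h3c (by
      rw [dd_neg, altDepthAux_one_neg]
      have := altDepthAux_le_dd_succ 1 R'
      omega) (by simp only [size]; omega)
  exact h3d.mono (transferLines_arith hlenDs)

/-! ### Packaging: from a depth-`d` proof of `¬ ofCNF T` to one of `¬ ofCNF T'` -/

/-- **A substitution instance of a bounded-depth proof is a bounded derivation**: applying `σ`
(formulas of size `≤ Zσ` and auxiliary depths `≤ Tσ`) to every line of a depth-`d` proof `π` of
`φ` gives a derivation of `φ.subst σ` with `≤ proofSize π` lines of disjunct depth `≤ d + Tσ` and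
size `≤ proofSize π · Zσ`. [cite: GalesiEtAl2023, §3.1 ("we apply the substitution to all the
queried formulas; size and depth do not change" up to the stated factors)] -/
theorem substProofBD {d : ℕ} {π : List (PropForm ℕ)} {φ : PropForm ℕ} (σ : ℕ → PropForm ℕ)
    {Zσ Tσ : ℕ} (hZ : ∀ x, (σ x).size ≤ Zσ) (hZ1 : 1 ≤ Zσ) (hT : ∀ x c, altDepthAux c (σ x) ≤ Tσ)
    (hπ : textbookFrege.IsDepthProofOf d π φ) :
    BD (d + Tσ) (proofSize π * Zσ) (proofSize π) (φ.subst σ) := by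
  have h := hπ.1.map_subst σ
  refine ⟨π.map (PropForm.subst σ), h.1, h.2, ?_, fun ψ hψ => ?_⟩
  · rw [List.length_map]; exact Complexity.length_le_proofSize π
  · obtain ⟨χ, hχ, rfl⟩ := List.mem_map.1 hψ
    constructor
    · have h1 := altDepthAux_subst_le (σ := σ) (T := Tσ) hT χ 3
      have h2 := altDepthAux_le_altDepth' 3 χ
      have h3 := hπ.2 χ hχ
      unfold dd; omega
    · exact (size_subst_le hZ hZ1 χ).trans (Nat.mul_le_mul_right _ (Complexity.size_le_proofSize hχ))

/-- Substitution into the rendering of a CNF, clause formula by clause formula. [folklore] -/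
theorem subst_ofCNF_eq_conjList (σ : ℕ → PropForm ℕ) (T : CNF ℕ) :
    (PropForm.ofCNF T).subst σ = conjList (T.map fun c => (clauseOf c).subst σ) := by
  rw [ofCNF_eq_conjList, subst_conjList, List.map_map]
  rfl

/-- Variables of a substitution instance come from the substituted formulas of the variables of
the schema. [folklore] -/
theorem mem_vars_subst {σ : ℕ → PropForm ℕ} {φ : PropForm ℕ} {x : ℕ} (h : x ∈ (φ.subst σ).vars) :
    ∃ y ∈ φ.vars, x ∈ (σ y).vars := by
  induction φ with
  | var y => exact ⟨y, by simp [PropForm.vars], by simpa [PropForm.subst] using h⟩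
  | const b => simp [PropForm.subst, PropForm.vars] at h
  | neg φ ih => exact ih (by simpa [PropForm.subst, PropForm.vars] using h)
  | conj φ ψ ih₁ ih₂ =>
    simp only [PropForm.subst, PropForm.vars, Finset.mem_union] at h
    rcases h with h | h
    · obtain ⟨y, hy, hx⟩ := ih₁ h; exact ⟨y, by simp [PropForm.vars, hy], hx⟩
    · obtain ⟨y, hy, hx⟩ := ih₂ h; exact ⟨y, by simp [PropForm.vars, hy], hx⟩
  | disj φ ψ ih₁ ih₂ =>
    simp only [PropForm.subst, PropForm.vars, Finset.mem_union] at h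
    rcases h with h | h
    · obtain ⟨y, hy, hx⟩ := ih₁ h; exact ⟨y, by simp [PropForm.vars, hy], hx⟩
    · obtain ⟨y, hy, hx⟩ := ih₂ h; exact ⟨y, by simp [PropForm.vars, hy], hx⟩

/-- `msum` of substitution instances. [folklore] -/
theorem msum_map_subst_le {σ : ℕ → PropForm ℕ} {Zσ : ℕ} (hZ : ∀ x, (σ x).size ≤ Zσ) (hZ1 : 1 ≤ Zσ)
    (L : List (PropForm ℕ)) : msum (L.map (PropForm.subst σ)) ≤ msum L * Zσ := by
  induction L with
  | nil => simp
  | cons A L ih =>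
    simp only [List.map_cons, msum_cons]
    have := size_subst_le hZ hZ1 A
    nlinarith

/-- The size of the proved formula is at most the size of the proof. [folklore] -/
theorem size_le_proofSize_of_isDepthProofOf {d : ℕ} {π : List (PropForm ℕ)} {φ : PropForm ℕ}
    (hπ : textbookFrege.IsDepthProofOf d π φ) : φ.size ≤ proofSize π :=
  Complexity.size_le_proofSize (List.mem_of_getLast? hπ.1.2)

/-- **Transfer of a bounded-depth refutation along a substitution** (GIRS Lemma 10 packaged for
`IsDepthProofOf`/`proofSize`). Let `π` be a depth-`d` `textbookFrege`-proof of `¬ ofCNF T`, `σ` a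
substitution by formulas of size `≤ Zσ` and auxiliary depths `≤ Tσ`, and `T'` a CNF such that every
substituted clause `(clauseOf c).subst σ`, `c ∈ T`, is implied by at most `qq` clauses of `T'`
jointly mentioning, with it, at most `k` (listed) variables. Then `¬ ofCNF T'` has a
depth-`(d + Tσ + 16)` proof of size at most `transferLines (proofSize π) Z qq k · B₀` with
`Z = proofSize π · Zσ + msum (T'.map clauseOf)` and `B₀ = 40 ((qq+3)(Z+3) + k) + 300`.
[cite: GalesiEtAl2023, Lemma 10 (with Lemma 2 and §3.1)] -/
theorem transfer_isDepthProofOf {d : ℕ} {π : List (PropForm ℕ)} (T T' : CNF ℕ)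
    (σ : ℕ → PropForm ℕ) {Zσ Tσ qq k : ℕ} (hZ : ∀ x, (σ x).size ≤ Zσ) (hZ1 : 1 ≤ Zσ)
    (hT : ∀ x c, altDepthAux c (σ x) ≤ Tσ)
    (hπ : textbookFrege.IsDepthProofOf d π (neg (PropForm.ofCNF T)))
    (hloc : ∀ c ∈ T, ∃ (Lc : List (Clause ℕ)) (V : List ℕ), (∀ C ∈ Lc, C ∈ T') ∧
      Lc.length ≤ qq ∧ V.Nodup ∧ V.length ≤ k ∧ (∀ x ∈ ((clauseOf c).subst σ).vars, x ∈ V) ∧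
      (∀ C ∈ Lc, ∀ x ∈ (clauseOf C).vars, x ∈ V) ∧
      ∀ τ : ℕ → Bool, (∀ C ∈ Lc, (clauseOf C).eval τ = true) →
        ((clauseOf c).subst σ).eval τ = true) :
    ∃ π', textbookFrege.IsDepthProofOf (d + Tσ + 16) π' (neg (PropForm.ofCNF T')) ∧
      proofSize π' ≤ transferLines (proofSize π) (proofSize π * Zσ + msum (T'.map clauseOf)) qq k *
        (40 * ((qq + 3) * (proofSize π * Zσ + msum (T'.map clauseOf) + 3) + k) + 300) := by
  set S := proofSize π with hS
  set Z := S * Zσ + msum (T'.map clauseOf) with hZdef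
  set B₀ := 40 * ((qq + 3) * (Z + 3) + k) + 300 with hB₀
  set Ds := T.map fun c => (clauseOf c).subst σ with hDs
  -- the substituted proof
  have h0 := substProofBD σ hZ hZ1 hT hπ
  rw [PropForm.subst, subst_ofCNF_eq_conjList] at h0
  have hSZ : S * Zσ ≤ B₀ := by
    have : Z + 3 ≤ (qq + 3) * (Z + 3) := Nat.le_mul_of_pos_left _ (by omega)
    omega
  have h0' : BD (d + Tσ + 15) B₀ S (neg (conjList Ds)) := h0.weaken (by omega) hSZ
  -- size of the source clauses after substitution
  have hmsDs : msum Ds ≤ Z := by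
    have h1 : (neg (PropForm.ofCNF T)).size ≤ S := size_le_proofSize_of_isDepthProofOf hπ
    rw [size, ofCNF_eq_conjList, size_conjList_eq_msum] at h1
    have h2 : msum Ds ≤ msum (T.map clauseOf) * Zσ := by
      have e : Ds = (T.map clauseOf).map (PropForm.subst σ) := by rw [hDs, List.map_map]; rfl
      rw [e]
      exact msum_map_subst_le hZ hZ1 _
    have h3 : msum (T.map clauseOf) * Zσ ≤ S * Zσ := Nat.mul_le_mul_right _ (by omega)
    omega
  -- apply the transfer
  have htr := transferS (D := d + Tσ + 15) (B := B₀) (q := Tσ + 3) (Z := Z) (qq := qq) (k := k)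
    Ds T' h0' ?_ (by omega) hmsDs (by omega) ?_ (by omega) le_rfl
  rotate_left
  · intro Dj hDj
    obtain ⟨c, -, rfl⟩ := List.mem_map.1 hDj
    have h1 : altDepthAux 0 ((clauseOf c).subst σ) ≤ altDepthAux 0 (clauseOf c) + Tσ :=
      altDepthAux_subst_le hT _ 0
    have h2 : altDepthAux 0 (clauseOf c) ≤ 2 := altDepth_clauseOf_le c
    show altDepthAux 0 _ ≤ _
    omega
  · intro Dj hDj
    obtain ⟨c, hc, rfl⟩ := List.mem_map.1 hDj
    exact hloc c hc
  obtain ⟨π', hπ', hsize⟩ := htr.exists_isDepthProofOf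
  exact ⟨π', ⟨hπ'.1, fun ψ hψ => (hπ'.2 ψ hψ).trans (by omega)⟩, hsize⟩

end TextbookFrege

end Literature.Computability.MetaComplexity
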